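import Summits.QuantumFields.YangMills.Theorems.BalabanUVNodesK1AxV11LettersDefs
import Summits.QuantumFields.YangMills.Theorems.BalabanUVNodesK1AxV11Roads
import Summits.QuantumFields.YangMills.Theses.BalabanUVNodes

/-!
# K1ᴬ (stmt-QuantumFields-27239) — THE v11.2 MIRROR, BY-NAME HALF: K1ᴬ BY ITS ROUTE NAME from the three v11.2 texts of either line
# (`Stub1TextVW`, `Stub2TextVW`, `Stub3LTextVW` ∕ `Stub1Text`, `Stub2Text`, `Stub3LText`), and from the ∀θ per-radius NAMED letters in place of the third text

Cell `pub-ymgap` (YM-PLAN Track A, D-0062), seat `pub-ymgap-dag-n24-c` (g25).  `--kind proof --supports stmt-QuantumFields-27239 --as helper`; COUNT-NEUTRAL; theorems only; standard axioms.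
Sequel of `…K1AxV11LettersDefs` (this seat; the route-independent half of the v11.2 mirror) over g23∕g24's ✓`…K1AxV11Roads.k1R9_of_stubs(VW)` (the kit's compositions, route-free)
and the route file imported DIRECTLY (the g24 rule; `lint.theses-cone`).  The first two texts are spelled unfolded (`∀ F, Inhabited13 F → NodesAtSomeRecord13PWSVW F`, …) because their
names `Stub1∕2TextVW` live in the Theses-cone file ✓`…K1AxV11StubTexts`; they agree by `δ`.

WHAT IS PROVED: ★ `stabilityBRunRowsAtRecordR13SepCoPHVAx_of_textsLVW` ∕ `…_of_textsL` — the registered kit's v11.2 concluders `k1R9_of_stubsVW stub_nodes13PWSVW stub_runRows13PWSVW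
(stubCont13VW_of_letters13VW stub_letters13VW)` (resp. LINE 1) read at the route decl, TYPE literally `Summit.QuantumFields.YangMills.Theses.BalabanUVNodes.StabilityBRunRowsAtRecordR13SepCoPHVAx`;
★★ `stabilityBRunRowsAtRecordR13SepCoPHVAx_of_texts12VW_of_letters₁₃AxAtRadius` — the same with the third text REPLACED by the ∀θ per-radius NAMED β-kernel letters (door
`K1AxStubCont13DoorOfKernelLetters.stubLetters13VW_of_letters₁₃AxAtRadius` of `…K1AxV11LettersDefs` §3).  CONDITIONAL on the displayed texts∕letters; closes nothing.

HONEST FRAMING (binding).  By-name bookkeeping; no registered stub closed (v11.2 0∕6); K1ᴬ OPEN; the letters are hypotheses inhabited nowhere; COUNT 8∕27 (A 8∕28) · K 1∕4 UNMOVED; R4 =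
the conditional finite-𝕋⁴ rung `BalabanLadder.UV` at fixed ε only — NOT continuum ∕ ℝ⁴ ∕ OS; the Yang–Mills mass gap (Clay) is NOT proved by any of this.
-/

noncomputable section

namespace Summit.QuantumFields.YangMills.Theorems.K1AxV11StubTexts

open Literature.MathematicalPhysics.QuantumFieldTheory.Balaban1983to89
open Literature.MathematicalPhysics.QuantumFieldTheory.Balaban1983to89.T4Continuum (T4Family)
open Summit.QuantumFields.YangMills.Theorems.K1AxV11Defs
open Summit.QuantumFields.YangMills.Theorems.K0RecordFormatNames (PolLimitLocUnifOnBox₁₃Ax PlimDecayOnBox₁₃Ax PvolHistContOnBox₁₃Ax)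
open Summit.QuantumFields.YangMills.Theorems.K1AxStubCont13DoorOfKernelLetters (stubLetters13VW_of_letters₁₃AxAtRadius stubLetters13_of_letters₁₃AxAtRadius)

/-- ★ **K1ᴬ BY ITS ROUTE NAME FROM LINE 2′'s THREE v11.2 TEXTS** (stub 1ⱽᵂ, stub 2ⱽᵂ texts unfolded; `Stub3LTextVW`): the kit's `k1R9_of_stubsVW` (✓`…K1AxV11Roads`) after the v11.2 bridge.
CONDITIONAL on the three texts; closes nothing. [cite: Balaban1989LargeFieldII, Thm 1 p.355 + (0.1) pp.355–356; Balaban1987RG1, Thm 3 p.264 (bookkeeping)] -/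
theorem stabilityBRunRowsAtRecordR13SepCoPHVAx_of_textsLVW
    (h₁ : ∀ F : T4Family, Inhabited13 F → NodesAtSomeRecord13PWSVW F)
    (h₂ : ∀ F : T4Family, NodesAtSomeRecord13PWSVW F → RunRowsAtSomeRecord13PWSVW F)
    (h₃ : Stub3LTextVW) :
    Summit.QuantumFields.YangMills.Theses.BalabanUVNodes.StabilityBRunRowsAtRecordR13SepCoPHVAx :=
  k1R9_of_stubsVW h₁ h₂ (stubCont13VW_text_of_stub3LTextVW h₃)

/-- ★ **K1ᴬ BY ITS ROUTE NAME FROM LINE 1's THREE v11.2 TEXTS** (`k1R9_of_stubs` after the LINE-1 bridge).  CONDITIONAL; closes nothing.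
[cite: Balaban1989LargeFieldII, Thm 1 p.355 + (0.1) pp.355–356; Balaban1987RG1, Thm 3 p.264 (bookkeeping)] -/
theorem stabilityBRunRowsAtRecordR13SepCoPHVAx_of_textsL
    (h₁ : ∀ F : T4Family, Inhabited13 F → NodesAtSomeRecord13PWS F)
    (h₂ : ∀ F : T4Family, NodesAtSomeRecord13PWS F → RunRowsAtSomeRecord13PWS F)
    (h₃ : Stub3LText) :
    Summit.QuantumFields.YangMills.Theses.BalabanUVNodes.StabilityBRunRowsAtRecordR13SepCoPHVAx :=
  k1R9_of_stubs h₁ h₂ (stubCont13_text_of_stub3LText h₃)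

/-- ★★ **K1ᴬ BY ITS ROUTE NAME FROM STUBS 1ⱽᵂ, 2ⱽᵂ (texts) AND THE ∀θ PER-RADIUS NAMED β-KERNEL LETTERS** in place of `stub_letters13VW` (door `stubLetters13VW_of_letters₁₃AxAtRadius`).
CONDITIONAL on the two texts and the letters at every rung-0 tuple; closes nothing. [cite: Balaban1989LargeFieldII, Thm 1 p.355 + (0.1) pp.355–356; Balaban1987RG1, Thm 1 p.259,
Thm 3 p.264, (1.20)–(1.22) p.264, (5.10) p.293 (bookkeeping)] -/
theorem stabilityBRunRowsAtRecordR13SepCoPHVAx_of_texts12VW_of_letters₁₃AxAtRadius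
    (h₁ : ∀ F : T4Family, Inhabited13 F → NodesAtSomeRecord13PWSVW F)
    (h₂ : ∀ F : T4Family, NodesAtSomeRecord13PWSVW F → RunRowsAtSomeRecord13PWSVW F)
    (H : ∀ (F : T4Family) (θ : Node00.Stage13HParams F 2), θ.Provisos₁₃SepCoPHAx F 2 → (θ.ZhUnity F 2 ∧ θ.SlotsNondegenerate₁₃Ax F 2) → θ.Admissible F 2 →
      ∃ γc : ℝ, 0 < γc ∧ γc ≤ θ.γ ∧ PolLimitLocUnifOnBox₁₃Ax F 2 θ.toStage13Params γc ∧ (∃ C δ₁ : ℝ, PlimDecayOnBox₁₃Ax F 2 θ.toStage13Params γc C δ₁) ∧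
        PvolHistContOnBox₁₃Ax F 2 θ.toStage13Params γc) :
    Summit.QuantumFields.YangMills.Theses.BalabanUVNodes.StabilityBRunRowsAtRecordR13SepCoPHVAx :=
  stabilityBRunRowsAtRecordR13SepCoPHVAx_of_textsLVW h₁ h₂ (stubLetters13VW_of_letters₁₃AxAtRadius H)

end Summit.QuantumFields.YangMills.Theorems.K1AxV11StubTexts

end
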